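import Literature.MeasureTheory.Group.InvariantFunctionalLocallyConstant        -- ★ COINV-1 `exists_forall_apply_eq_const_mul_integral_of_smul_invariant` + rider `isOpenPosMeasure_of_smulInvariantMeasure_ne_zero`
import Literature.NumberTheory.Rogawski1990.ShalikaGermExpansionInvariantKernel   -- ★ SH-2 `isLocSmooth_of_mem_span_conj_sub` (+ `IsLocSmooth`, `descConj`, `orbitalIntegral`)
import Literature.Topology.LocallyConstantExtend                                   -- ★ LIFT `exists_isLocallyConstant_hasCompactSupport_comp_eq`, `exists_isCompact_isOpen_superset_subset`
import Literature.NumberTheory.Rogawski1990.LocalTransferGlue                      -- ★ `IsLocSmooth.add`, `IsLocSmooth.indicator`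
import Literature.Topology.Algebra.CompactOpenSubgroupOfLocallyCompact                -- ★ van Dantzig `exists_isCompact_isOpen_subgroup` (p849165)
import Mathlib.Topology.Algebra.Group.OpenMapping
import Mathlib.LinearAlgebra.Dual.Lemmas
import Mathlib.GroupTheory.GroupAction.ConjAct
import Mathlib.Topology.LocallyClosed
import HarnessLib

/-!
# The kernel of the orbital integrals on ONE locally closed orbit: `∫_O ψ dμ_O = 0 ⇒ ψ` is a sum of coinvariant differences,
# lifted off a closed invariant set (the stratum step of the Howe ∕ Harish-Chandra induction)

Topic `MeasureTheory/Group`; namespace `Literature.MeasureTheory.Group`.  THEOREMS ONLY (no definition, no instance, no notation, no named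
fact, no `sorry`).  GENERIC: `G` a locally compact, Hausdorff, totally disconnected, second countable topological group.  FILE A of the organ
SPAN-e «SPAN-ASSEMBLY» of the LH4 Shalika pay-down (cell `pub/hodgecm-mathlib`, crux H413 = `stmt-HodgeConjecture-24833`, print row
`stub_N6nsShalika` = ★ def `ShalikaGermExpansionNonsplit`, [Rogawski1990, Prop. 8.1.1 p. 112]); FILE B `OrbitalIntegralKernelDecomposition` runs the
induction over a finite closed filtration by conjugacy classes and states the organ's head.

THE STRATUM STEP ([Rogawski1990, p. 113 ll. 7–20], [Howe1974, Prop. 2], [BernsteinZelevinsky1976, §1], [HarishChandra1999AdmissibleDistributions, §3]).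
Let `O = 𝒪(γ₀)` be a conjugacy class which is LOCALLY CLOSED in `G`, `m` a non-zero `G`-invariant measure on `G ⧸ C(γ₀)` at which every `φ ∈ C_c^∞(G)`
has an integrable orbital integrand (the Ranga-Rao clause), `Z ⊆ G` a closed conjugation-invariant set disjoint from `O`, and `F₁ ∈ C_c^∞(G)` with
`tsupport F₁ ∩ Z = ∅`, `tsupport F₁ ∩ closure O ⊆ O` and `O_{γ₀}^m(F₁) = 0`.  THEN there is `Ψ ∈ C₀ := span{φ^x − φ : φ ∈ C_c^∞(G)}` with `Ψ = F₁` on `O`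
and `tsupport Ψ ∩ Z = ∅` (`exists_mem_span_conj_sub_eqOn_of_orbitalIntegral_eq_zero`).
Proof.  On the subtype `X := ↥O` the group `ConjAct G` acts continuously and transitively with OPEN orbit maps (Mathlib's open-mapping theorem
`isOpenMap_smul_of_sigmaCompact`: `O` locally closed ⇒ locally compact ⇒ Baire); the orbit map `θ : G ⧸ C(γ₀) → X` transports `m` to a
`ConjAct G`-invariant measure `μ_O` on `X`, finite on compacta (by the Rao clause at the indicator of a compact open cover) and positive on opens
(★ rider of COINV-1), with `∫_X (F ∘ ↑) dμ_O = O_{γ₀}^m(F)`.  ★ COINV-1 (uniqueness of invariant functionals on `S(X)`, [BernsteinZelevinsky1976 §1.18]) in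
its primal form — via a separating functional, Mathlib `Submodule.exists_dual_map_eq_bot_of_notMem` — says that `ψ ∈ S(X)` with `∫ ψ dμ_O = 0` lies in
`span{φ(g • ·) − φ : φ ∈ S(X)}` (`mem_span_smul_sub_of_integral_eq_zero`).  Each generator is lifted to `C₀` with support off `Z` by ★
`Literature.Topology.exists_isLocallyConstant_hasCompactSupport_comp_eq` and a compact open cut-off (★ `exists_isCompact_isOpen_superset_subset`).

CONTENTS.  §1 `mem_span_smul_sub_of_integral_eq_zero` (generic homogeneous space).  §2 the orbit subtype and the transported orbit measure
(`descConj_id_mem_orbit`, equivariance, invariance, finiteness on compacta from the Rao clause, non-vanishing, `integral_comp_coe_map_eq_orbitalIntegral`).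
§3 test functions on the stratum: restriction (`hasCompactSupport_comp_coe_of_tsupport_inter_closure_subset`) and lifting off a closed invariant set
(`exists_isLocSmooth_comp_coe_eq_of_disjoint`, `exists_mem_span_conj_sub_comp_coe_eq`).  §4 the stratum step.
HONEST LABEL: pure measure theory ∕ topology, count-neutral; HC_CM is proved only modulo the 7 printed citations (2 remaining: hLiu418 =
stmt-HodgeConjecture-24832, h413 = stmt-HodgeConjecture-24833) until rung 0 closes; nothing printed is proved here.

## References
* [BernsteinZelevinsky1976] I. N. Bernstein, A. V. Zelevinsky, *Representations of the group GL(n, F) where F is a non-archimedean local field*, Russian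
  Math. Surveys 31:3 (1976): §1 (`ℓ`-spaces, `S(X)`, Prop. 1.8, invariant distributions on homogeneous spaces §1.18 ff.).
* [HarishChandra1999AdmissibleDistributions] Harish-Chandra (notes by S. DeBacker, P. J. Sally, Jr.), *Admissible Invariant Distributions on Reductive
  p-adic Groups*, AMS ULS 16 (1999): §3.1 p. 17, Thm. 8.1 p. 48.
* [Rogawski1990] J. D. Rogawski, *Automorphic Representations of Unitary Groups in Three Variables*, Ann. of Math. Stud. 123 (1990): §8.1, proof of Prop.
  8.1.1 p. 113 (Howe's argument).
* [Howe1974] R. Howe, *The Fourier transform and germs of characters (case of Gl_n over a p-adic field)*, Math. Ann. 208 (1974) 305–322: Prop. 2.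
-/

set_option autoImplicit false

noncomputable section

open Set Filter Topology MulAction MeasureTheory MeasureTheory.Measure
open Literature.NumberTheory.Rogawski1990 Literature.NumberTheory.Automorphic Literature.Topology
open scoped Pointwise

namespace Literature.MeasureTheory.Group

/-! ## §1 COINV-1 in primal form: on one homogeneous space, `∫ ψ dμ = 0 ⇒ ψ ∈ span{φ(g • ·) − φ}` -/

section CoinvariantSpan

variable {Γ : Type*} [Group Γ] [TopologicalSpace Γ] [IsTopologicalGroup Γ] [TotallyDisconnectedSpace Γ]
  {X : Type*} [TopologicalSpace X] [MulAction Γ X] [ContinuousSMul Γ X] [MeasurableSpace X] [OpensMeasurableSpace X]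

/-- **COINV-1, primal form.**  `Γ` a totally disconnected group with a compact open subgroup `K₀` (van Dantzig: any locally compact Hausdorff totally
disconnected group, ★ `Literature.Topology.Algebra.exists_isCompact_isOpen_subgroup`) acting continuously and transitively on `X` with open orbit maps, `μ` an invariant measure on `X` finite on compacta and positive on opens.  A locally constant compactly supported
`ψ : X → ℂ` with `∫ ψ dμ = 0` lies in the span of the coinvariant differences `φ(g • ·) − φ`, `φ ∈ S(X)`: otherwise a linear functional separating `ψ` from
that span (Mathlib `Submodule.exists_dual_map_eq_bot_of_notMem`) would be invariant on `S(X)`, hence `c · ∫ · dμ` by ★ COINV-1, and would kill `ψ`.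
[cite: BernsteinZelevinsky1976, §1.18] [cite: HarishChandra1999AdmissibleDistributions, §3.1 p. 17] -/
theorem mem_span_smul_sub_of_integral_eq_zero (K₀ : Subgroup Γ) (hK₀o : IsOpen (K₀ : Set Γ)) (hK₀c : IsCompact (K₀ : Set Γ))
    (hopen : ∀ x : X, IsOpenMap fun g : Γ => g • x) [IsPretransitive Γ X]
    (μ : Measure X) [SMulInvariantMeasure Γ X μ] [IsFiniteMeasureOnCompacts μ] [μ.IsOpenPosMeasure]
    {ψ : X → ℂ} (hψ : IsLocallyConstant ψ) (hψs : HasCompactSupport ψ) (h0 : ∫ x, ψ x ∂μ = 0) :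
    ψ ∈ Submodule.span ℂ {χ : X → ℂ | ∃ (g : Γ) (φ : X → ℂ), IsLocallyConstant φ ∧ HasCompactSupport φ ∧ χ = (fun x => φ (g • x)) - φ} := by
  set W : Submodule ℂ (X → ℂ) :=
    Submodule.span ℂ {χ : X → ℂ | ∃ (g : Γ) (φ : X → ℂ), IsLocallyConstant φ ∧ HasCompactSupport φ ∧ χ = (fun x => φ (g • x)) - φ} with hW
  by_contra hnot
  obtain ⟨T, hTψ, hTW⟩ := Submodule.exists_dual_map_eq_bot_of_notMem hnot inferInstance
  have hT : ∀ F : X → ℂ, IsLocallyConstant F → HasCompactSupport F → ∀ g : Γ, T (fun y => F (g • y)) = T F := by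
    intro F hF hFs g
    have hmem : (fun y => F (g • y)) - F ∈ W := Submodule.subset_span ⟨g, F, hF, hFs, rfl⟩
    have hzero : T ((fun y => F (g • y)) - F) = 0 := by
      have h1 : T ((fun y => F (g • y)) - F) ∈ W.map T := Submodule.mem_map_of_mem hmem
      rw [hTW] at h1
      exact (Submodule.mem_bot ℂ).1 h1
    rwa [map_sub, sub_eq_zero] at hzero
  obtain ⟨c, hc⟩ := exists_forall_apply_eq_const_mul_integral_of_smul_invariant K₀ hK₀o hK₀c hopen μ T hT
  exact hTψ (by rw [hc ψ hψ hψs, h0, mul_zero])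

end CoinvariantSpan

/-! ## §2 The stratum as a `ConjAct G`-space: the orbit map `G ⧸ C(γ₀) → ↥𝒪(γ₀)` and the transported orbit measure -/

section Stratum

variable {G : Type*} [Group G]

/-- The orbit map `y C(γ₀) ↦ y γ₀ y⁻¹` (★ `descConj γ₀ C(γ₀) _ id`) lands in the conjugacy class `𝒪(γ₀) = orbit (ConjAct G) γ₀`. [cite: BernsteinZelevinsky1976, §1.5] -/
theorem descConj_id_mem_orbit (γ₀ : G) (y : G ⧸ Subgroup.centralizer ({γ₀} : Set G)) :
    descConj γ₀ (Subgroup.centralizer ({γ₀} : Set G)) (fun _ hg => Subgroup.mem_centralizer_singleton_iff.1 hg) id y ∈ orbit (ConjAct G) γ₀ := by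
  induction y using QuotientGroup.induction_on with
  | H g =>
    rw [descConj_mk, ConjAct.mem_orbit_conjAct]
    exact (isConj_iff.2 ⟨g, rfl⟩).symm

/-- **Equivariance of the orbit map**: `θ(g • y) = (toConjAct g) • θ(y)`. [cite: BernsteinZelevinsky1976, §1.5] -/
theorem codRestrict_descConj_id_smul (γ₀ : G) (g : G) (y : G ⧸ Subgroup.centralizer ({γ₀} : Set G)) :
    Set.codRestrict (descConj γ₀ (Subgroup.centralizer ({γ₀} : Set G)) (fun _ hg => Subgroup.mem_centralizer_singleton_iff.1 hg) id)
        (orbit (ConjAct G) γ₀) (descConj_id_mem_orbit γ₀) (g • y) =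
      ConjAct.toConjAct g • Set.codRestrict (descConj γ₀ (Subgroup.centralizer ({γ₀} : Set G)) (fun _ hg => Subgroup.mem_centralizer_singleton_iff.1 hg) id)
        (orbit (ConjAct G) γ₀) (descConj_id_mem_orbit γ₀) y := by
  induction y using QuotientGroup.induction_on with
  | H x =>
    apply Subtype.ext
    change (g * x) * γ₀ * (g * x)⁻¹ = g * (x * γ₀ * x⁻¹) * g⁻¹
    simp only [mul_inv_rev, mul_assoc]

/-- `(F ∘ ↑) ∘ θ` is the orbital integrand `descConj γ₀ C(γ₀) _ F`. [cite: Rogawski1990, §4.9 p. 54] -/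
theorem comp_coe_comp_codRestrict_descConj_id (γ₀ : G) {α : Type*} (F : G → α) :
    (fun x : orbit (ConjAct G) γ₀ => F (x : G)) ∘ Set.codRestrict (descConj γ₀ (Subgroup.centralizer ({γ₀} : Set G))
        (fun _ hg => Subgroup.mem_centralizer_singleton_iff.1 hg) id) (orbit (ConjAct G) γ₀) (descConj_id_mem_orbit γ₀) =
      descConj γ₀ (Subgroup.centralizer ({γ₀} : Set G)) (fun _ hg => Subgroup.mem_centralizer_singleton_iff.1 hg) F := by
  funext y
  induction y using QuotientGroup.induction_on with
  | H x => rfl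

variable [TopologicalSpace G] [IsTopologicalGroup G]

/-- The orbit map `θ : G ⧸ C(γ₀) → ↥𝒪(γ₀)` is continuous. [cite: BernsteinZelevinsky1976, §1.5] -/
theorem continuous_codRestrict_descConj_id (γ₀ : G) :
    Continuous (Set.codRestrict (descConj γ₀ (Subgroup.centralizer ({γ₀} : Set G)) (fun _ hg => Subgroup.mem_centralizer_singleton_iff.1 hg) id)
      (orbit (ConjAct G) γ₀) (descConj_id_mem_orbit γ₀)) :=
  (continuous_descConj γ₀ _ _ continuous_id).codRestrict _

variable [MeasurableSpace G] [BorelSpace G] (γ₀ : G)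
  [MeasurableSpace (G ⧸ Subgroup.centralizer ({γ₀} : Set G))] [BorelSpace (G ⧸ Subgroup.centralizer ({γ₀} : Set G))]
  (m : Measure (G ⧸ Subgroup.centralizer ({γ₀} : Set G)))

/-- **The transported orbit measure is `ConjAct G`-invariant** (`m` is `G`-invariant on `G ⧸ C(γ₀)` and `θ` is equivariant). [cite: BernsteinZelevinsky1976, §1.18] -/
theorem smulInvariantMeasure_map_codRestrict_descConj_id [SMulInvariantMeasure G (G ⧸ Subgroup.centralizer ({γ₀} : Set G)) m] :
    SMulInvariantMeasure (ConjAct G) (orbit (ConjAct G) γ₀)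
      (m.map (Set.codRestrict (descConj γ₀ (Subgroup.centralizer ({γ₀} : Set G)) (fun _ hg => Subgroup.mem_centralizer_singleton_iff.1 hg) id)
        (orbit (ConjAct G) γ₀) (descConj_id_mem_orbit γ₀))) := by
  set θ := Set.codRestrict (descConj γ₀ (Subgroup.centralizer ({γ₀} : Set G)) (fun _ hg => Subgroup.mem_centralizer_singleton_iff.1 hg) id)
        (orbit (ConjAct G) γ₀) (descConj_id_mem_orbit γ₀) with hθ
  have hθm : Measurable θ := (continuous_codRestrict_descConj_id γ₀).measurable
  refine ⟨fun c s hs => ?_⟩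
  have hcm : Measurable fun x : orbit (ConjAct G) γ₀ => c • x := by
    refine Measurable.subtype_mk ?_
    show Measurable fun x : orbit (ConjAct G) γ₀ => ConjAct.ofConjAct c * (x : G) * (ConjAct.ofConjAct c)⁻¹
    exact (measurable_subtype_coe.const_mul _).mul_const _
  have hcs : MeasurableSet ((fun x : orbit (ConjAct G) γ₀ => c • x) ⁻¹' s) := hcm hs
  rw [Measure.map_apply hθm hs, Measure.map_apply hθm hcs]
  have hpre : θ ⁻¹' ((fun x : orbit (ConjAct G) γ₀ => c • x) ⁻¹' s) =
      (fun y : G ⧸ Subgroup.centralizer ({γ₀} : Set G) => ConjAct.ofConjAct c • y) ⁻¹' (θ ⁻¹' s) := by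
    ext y
    simp only [mem_preimage]
    rw [hθ, codRestrict_descConj_id_smul γ₀ (ConjAct.ofConjAct c) y, ConjAct.toConjAct_ofConjAct]
  rw [hpre, SMulInvariantMeasure.measure_preimage_smul (ConjAct.ofConjAct c) (hθm hs)]

/-- **The transported orbit measure is finite on compact subsets of the stratum** — from the RANGA-RAO CLAUSE at `γ₀` (integrability of the orbital
integrand of every `f ∈ C_c^∞(G)`), applied to the indicator of a compact open `K′ ⊇ K` (★ `exists_isCompact_isOpen_superset_subset`): no properness of the
orbit map is used. [cite: HarishChandra1999AdmissibleDistributions, §3.1 p. 17] [cite: Rogawski1990, §8.1 p. 112] -/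
theorem isFiniteMeasureOnCompacts_map_codRestrict_descConj_id [LocallyCompactSpace G] [T2Space G] [TotallyDisconnectedSpace G]
    (hRao : ∀ f : G → ℂ, IsLocSmooth f →
      Integrable (descConj γ₀ (Subgroup.centralizer ({γ₀} : Set G)) (fun _ hg => Subgroup.mem_centralizer_singleton_iff.1 hg) f) m) :
    IsFiniteMeasureOnCompacts
      (m.map (Set.codRestrict (descConj γ₀ (Subgroup.centralizer ({γ₀} : Set G)) (fun _ hg => Subgroup.mem_centralizer_singleton_iff.1 hg) id)
        (orbit (ConjAct G) γ₀) (descConj_id_mem_orbit γ₀))) := by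
  set θ := Set.codRestrict (descConj γ₀ (Subgroup.centralizer ({γ₀} : Set G)) (fun _ hg => Subgroup.mem_centralizer_singleton_iff.1 hg) id)
        (orbit (ConjAct G) γ₀) (descConj_id_mem_orbit γ₀) with hθ
  have hθm : Measurable θ := (continuous_codRestrict_descConj_id γ₀).measurable
  refine ⟨fun K hK => ?_⟩
  -- a compact open `K′ ⊆ G` containing the image of `K`
  have hKG : IsCompact (((↑) : orbit (ConjAct G) γ₀ → G) '' K) := hK.image continuous_subtype_val
  obtain ⟨K', hK'c, hK'o, hKK', -⟩ := exists_isCompact_isOpen_superset_subset hKG isOpen_univ (subset_univ _)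
  have hind : IsLocSmooth ((K' : Set G).indicator fun _ => (1 : ℂ)) := isLocSmooth_indicator hK'o hK'c.isClosed hK'c
  have hint := hRao _ hind
  -- the orbital integrand of `1_{K′}` is the indicator of the preimage of `K′` under the orbit map
  set A : Set (G ⧸ Subgroup.centralizer ({γ₀} : Set G)) :=
    (descConj γ₀ (Subgroup.centralizer ({γ₀} : Set G)) (fun _ hg => Subgroup.mem_centralizer_singleton_iff.1 hg) id) ⁻¹' K' with hA
  have hAm : MeasurableSet A := (continuous_descConj γ₀ _ _ continuous_id).measurable hK'o.measurableSet
  have hdesc : descConj γ₀ (Subgroup.centralizer ({γ₀} : Set G)) (fun _ hg => Subgroup.mem_centralizer_singleton_iff.1 hg)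
      ((K' : Set G).indicator fun _ => (1 : ℂ)) = A.indicator fun _ => (1 : ℂ) := by
    funext y
    rw [descConj_eq_comp, Function.comp_apply]
    by_cases h : descConj γ₀ (Subgroup.centralizer ({γ₀} : Set G)) (fun _ hg => Subgroup.mem_centralizer_singleton_iff.1 hg) id y ∈ K'
    · rw [indicator_of_mem h, indicator_of_mem (show y ∈ A from h)]
    · rw [indicator_of_notMem h, indicator_of_notMem (show y ∉ A from h)]
  rw [hdesc, integrable_indicator_iff hAm] at hint
  have hAfin : m A < ⊤ := ((integrableOn_const_iff).1 hint).resolve_left (by simp)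
  -- `θ ⁻¹' K ⊆ A`
  rw [Measure.map_apply hθm hK.measurableSet]
  refine lt_of_le_of_lt (measure_mono fun y hy => ?_) hAfin
  have : ((θ y : orbit (ConjAct G) γ₀) : G) ∈ ((↑) : orbit (ConjAct G) γ₀ → G) '' K := mem_image_of_mem _ hy
  exact hKK' (by simpa [hθ] using this)

/-- The transported orbit measure is non-zero when `m ≠ 0`. [cite: BernsteinZelevinsky1976, §1.18] -/
theorem map_codRestrict_descConj_id_ne_zero (hm : m ≠ 0) :
    m.map (Set.codRestrict (descConj γ₀ (Subgroup.centralizer ({γ₀} : Set G)) (fun _ hg => Subgroup.mem_centralizer_singleton_iff.1 hg) id)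
        (orbit (ConjAct G) γ₀) (descConj_id_mem_orbit γ₀)) ≠ 0 := by
  intro h
  have hθm : Measurable (Set.codRestrict (descConj γ₀ (Subgroup.centralizer ({γ₀} : Set G)) (fun _ hg => Subgroup.mem_centralizer_singleton_iff.1 hg) id)
        (orbit (ConjAct G) γ₀) (descConj_id_mem_orbit γ₀)) := (continuous_codRestrict_descConj_id γ₀).measurable
  have huniv := congrArg (fun ν : Measure (orbit (ConjAct G) γ₀) => ν univ) h
  simp only [Measure.map_apply hθm MeasurableSet.univ, preimage_univ, Measure.coe_zero, Pi.zero_apply] at huniv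
  exact hm (Measure.measure_univ_eq_zero.1 huniv)

/-- **Change of variables**: `∫_{↥𝒪(γ₀)} F(x) dμ_O(x) = O_{γ₀}^m(F)` for a Borel `F : G → ℂ`. [cite: Rogawski1990, §4.9 p. 54] -/
theorem integral_comp_coe_map_eq_orbitalIntegral {F : G → ℂ} (hF : Measurable F) :
    ∫ x, F (x : G) ∂(m.map (Set.codRestrict (descConj γ₀ (Subgroup.centralizer ({γ₀} : Set G)) (fun _ hg => Subgroup.mem_centralizer_singleton_iff.1 hg) id)
        (orbit (ConjAct G) γ₀) (descConj_id_mem_orbit γ₀))) = orbitalIntegral γ₀ F m := by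
  have hθm : Measurable (Set.codRestrict (descConj γ₀ (Subgroup.centralizer ({γ₀} : Set G)) (fun _ hg => Subgroup.mem_centralizer_singleton_iff.1 hg) id)
        (orbit (ConjAct G) γ₀) (descConj_id_mem_orbit γ₀)) := (continuous_codRestrict_descConj_id γ₀).measurable
  have hFm : AEStronglyMeasurable (fun x : orbit (ConjAct G) γ₀ => F (x : G))
      (m.map (Set.codRestrict (descConj γ₀ (Subgroup.centralizer ({γ₀} : Set G)) (fun _ hg => Subgroup.mem_centralizer_singleton_iff.1 hg) id)
        (orbit (ConjAct G) γ₀) (descConj_id_mem_orbit γ₀))) :=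
    (hF.comp measurable_subtype_coe).aestronglyMeasurable
  rw [MeasureTheory.integral_map hθm.aemeasurable hFm, orbitalIntegral_eq_integral_descConj]
  exact congrArg (fun f => ∫ y, f y ∂m) (comp_coe_comp_codRestrict_descConj_id γ₀ F)

end Stratum

/-! ## §3 Test functions on the stratum: restriction to `↥O` and lifting off a closed invariant set -/

section TestFunctions

variable {G : Type*} [TopologicalSpace G] [T2Space G]

/-- Restriction of a test function whose support avoids the BOUNDARY of `O` (`tsupport F ∩ closure O ⊆ O`) to the subtype `↥O` has compact support.
[cite: BernsteinZelevinsky1976, §1.1] -/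
theorem hasCompactSupport_comp_coe_of_tsupport_inter_closure_subset {O : Set G} {F : G → ℂ} (hFs : HasCompactSupport F)
    (hsupp : tsupport F ∩ closure O ⊆ O) : HasCompactSupport fun x : O => F (x : G) := by
  -- the candidate compact set: the preimage of `tsupport F` in `↥O`
  have hc : IsCompact (((↑) : O → G) ⁻¹' tsupport F) := by
    rw [Subtype.isCompact_iff]
    have himg : ((↑) : O → G) '' (((↑) : O → G) ⁻¹' tsupport F) = tsupport F ∩ closure O ∩ O := by
      rw [image_preimage_eq_inter_range, Subtype.range_coe]
      ext g
      exact ⟨fun ⟨h1, h2⟩ => ⟨⟨h1, subset_closure h2⟩, h2⟩, fun ⟨⟨h1, _⟩, h2⟩ => ⟨h1, h2⟩⟩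
    rw [himg]
    have hcl : IsClosed (tsupport F ∩ closure O) := (isClosed_tsupport F).inter isClosed_closure
    have heq : tsupport F ∩ closure O ∩ O = tsupport F ∩ closure O :=
      inter_eq_left.2 hsupp
    rw [heq]
    exact hFs.isCompact.of_isClosed_subset hcl inter_subset_left
  refine HasCompactSupport.of_support_subset_isCompact hc fun x hx => ?_
  exact subset_tsupport F hx

variable [LocallyCompactSpace G] [TotallyDisconnectedSpace G]

/-- **Lift off a closed set.**  A locally constant compactly supported `φ` on the subtype `↥O` extends to `Φ ∈ C_c^∞(G)` with `Φ ∘ ↑ = φ` whose support avoids a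
given closed `Z` disjoint from `O` (★ LIFT `exists_isLocallyConstant_hasCompactSupport_comp_eq`, then a compact open cut-off containing the support and missing
`Z`, ★ `exists_isCompact_isOpen_superset_subset`). [cite: BernsteinZelevinsky1976, Prop. 1.8] -/
theorem exists_isLocSmooth_comp_coe_eq_of_disjoint {O Z : Set G} (hZ : IsClosed Z) (hZO : Disjoint Z O) {φ : O → ℂ}
    (hφ : IsLocallyConstant φ) (hφs : HasCompactSupport φ) :
    ∃ Φ : G → ℂ, IsLocSmooth Φ ∧ (fun x : O => Φ (x : G)) = φ ∧ Disjoint (tsupport Φ) Z := by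
  obtain ⟨Φ₁, hΦ₁, hΦ₁s, hΦ₁φ⟩ := exists_isLocallyConstant_hasCompactSupport_comp_eq hφ hφs
  -- the support of `φ`, seen in `G`, is compact and misses `Z`
  have hKc : IsCompact (((↑) : O → G) '' tsupport φ) := hφs.isCompact.image continuous_subtype_val
  have hKZ : ((↑) : O → G) '' tsupport φ ⊆ Zᶜ := by
    rintro _ ⟨x, -, rfl⟩ hxZ
    exact hZO.le_bot ⟨hxZ, x.2⟩
  obtain ⟨K', hK'c, hK'o, hKK', hK'Z⟩ := exists_isCompact_isOpen_superset_subset hKc hZ.isOpen_compl hKZ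
  refine ⟨K'.indicator Φ₁, IsLocSmooth.indicator ⟨hΦ₁, hΦ₁s⟩ ⟨hK'c.isClosed, hK'o⟩, funext fun x => ?_, ?_⟩
  · by_cases hx : (x : G) ∈ K'
    · rw [indicator_of_mem hx]
      exact congrFun hΦ₁φ x
    · rw [indicator_of_notMem hx]
      have hx' : x ∉ tsupport φ := fun h => hx (hKK' ⟨x, h, rfl⟩)
      exact (image_eq_zero_of_notMem_tsupport hx').symm
  · exact disjoint_left.2 fun g hg hgZ => hK'Z ((closure_minimal support_indicator_subset hK'c.isClosed) hg) hgZ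

/-- **Lift of the coinvariant span off a closed invariant set.**  An element of `span{φ(c • ·) − φ : φ ∈ S(↥𝒪(γ₀))}` on the stratum is the restriction of an
element `Ψ` of `C₀ = span{Φ^x − Φ : Φ ∈ C_c^∞(G)}` whose support misses a given closed conjugation-invariant `Z` disjoint from `𝒪(γ₀)` (generator by generator:
`exists_isLocSmooth_comp_coe_eq_of_disjoint`, then `Ψ := Φ^x − Φ`, `x := ofConjAct c`; `Z` is invariant, so `tsupport Φ^x = x⁻¹ (tsupport Φ) x` misses it too).
[cite: BernsteinZelevinsky1976, Prop. 1.8] [cite: Rogawski1990, §8.1 p. 113] -/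
theorem exists_mem_span_conj_sub_comp_coe_eq [Group G] [IsTopologicalGroup G] (γ₀ : G) {Z : Set G} (hZ : IsClosed Z)
    (hZinv : ∀ x g : G, g ∈ Z → x * g * x⁻¹ ∈ Z) (hZO : Disjoint Z (orbit (ConjAct G) γ₀)) {ψ : orbit (ConjAct G) γ₀ → ℂ}
    (hψ : ψ ∈ Submodule.span ℂ {χ : orbit (ConjAct G) γ₀ → ℂ | ∃ (c : ConjAct G) (φ : orbit (ConjAct G) γ₀ → ℂ),
      IsLocallyConstant φ ∧ HasCompactSupport φ ∧ χ = (fun x => φ (c • x)) - φ}) :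
    ∃ Ψ : G → ℂ, Ψ ∈ Submodule.span ℂ {ψ : G → ℂ | ∃ (x : G) (φ : G → ℂ), IsLocSmooth φ ∧ ψ = (fun g => φ (x * g * x⁻¹)) - φ} ∧
      (fun x : orbit (ConjAct G) γ₀ => Ψ (x : G)) = ψ ∧ Disjoint (tsupport Ψ) Z := by
  induction hψ using Submodule.span_induction with
  | mem χ hχ =>
    obtain ⟨c, φ, hφ, hφs, rfl⟩ := hχ
    obtain ⟨Φ, hΦ, hΦφ, hΦZ⟩ := exists_isLocSmooth_comp_coe_eq_of_disjoint hZ hZO hφ hφs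
    refine ⟨(fun g => Φ (ConjAct.ofConjAct c * g * (ConjAct.ofConjAct c)⁻¹)) - Φ,
      Submodule.subset_span ⟨ConjAct.ofConjAct c, Φ, hΦ, rfl⟩, ?_, ?_⟩
    · funext x
      have h1 : Φ (ConjAct.ofConjAct c * (x : G) * (ConjAct.ofConjAct c)⁻¹) = φ (c • x) := by
        rw [← congrFun hΦφ (c • x)]
        rfl
      have h2 : Φ (x : G) = φ x := congrFun hΦφ x
      simp only [Pi.sub_apply, h1, h2]
    · refine (Set.disjoint_of_subset_left (tsupport_sub _ _)) (Set.disjoint_union_left.2 ⟨?_, hΦZ⟩)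
      -- `tsupport (Φ ∘ conj_x) ⊆ conj_x ⁻¹' (tsupport Φ)` and `Z` is `conj_x`-invariant
      refine Set.disjoint_left.2 fun g hg hgZ => ?_
      have hcont : Continuous fun g : G => ConjAct.ofConjAct c * g * (ConjAct.ofConjAct c)⁻¹ :=
        (continuous_const.mul continuous_id).mul continuous_const
      have hsub : tsupport (fun g => Φ (ConjAct.ofConjAct c * g * (ConjAct.ofConjAct c)⁻¹)) ⊆
          (fun g => ConjAct.ofConjAct c * g * (ConjAct.ofConjAct c)⁻¹) ⁻¹' tsupport Φ := by
        refine (closure_mono ?_).trans (hcont.closure_preimage_subset _)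
        intro g hg'
        exact hg'
      exact Set.disjoint_left.1 hΦZ (hsub hg) (hZinv _ _ hgZ)
  | zero => exact ⟨0, Submodule.zero_mem _, rfl, by simp⟩
  | add χ₁ χ₂ _ _ h₁ h₂ =>
    obtain ⟨Ψ₁, hΨ₁, hΨ₁χ, hΨ₁Z⟩ := h₁
    obtain ⟨Ψ₂, hΨ₂, hΨ₂χ, hΨ₂Z⟩ := h₂
    refine ⟨Ψ₁ + Ψ₂, Submodule.add_mem _ hΨ₁ hΨ₂, ?_, ?_⟩
    · funext x
      simp only [Pi.add_apply, ← hΨ₁χ, ← hΨ₂χ]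
    · exact (Set.disjoint_of_subset_left (tsupport_add Ψ₁ Ψ₂)) (Set.disjoint_union_left.2 ⟨hΨ₁Z, hΨ₂Z⟩)
  | smul a χ _ h =>
    obtain ⟨Ψ, hΨ, hΨχ, hΨZ⟩ := h
    refine ⟨a • Ψ, Submodule.smul_mem _ a hΨ, ?_, ?_⟩
    · funext x
      simp only [Pi.smul_apply, ← hΨχ]
    · exact Set.disjoint_of_subset_left (closure_mono (Function.support_const_smul_subset a Ψ)) hΨZ

end TestFunctions

/-! ## §4 The stratum step -/

section StratumStep

variable {G : Type*} [Group G] [TopologicalSpace G] [IsTopologicalGroup G] [LocallyCompactSpace G] [T2Space G]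
  [TotallyDisconnectedSpace G] [SecondCountableTopology G] [MeasurableSpace G] [BorelSpace G]

/-- **THE STRATUM STEP.**  `𝒪(γ₀)` a LOCALLY CLOSED conjugacy class; `m ≠ 0` a `G`-invariant measure on `G ⧸ C(γ₀)` with the Ranga-Rao clause (every `f ∈ C_c^∞(G)`
has an integrable orbital integrand at `γ₀`); `Z` closed, conjugation-invariant, disjoint from `𝒪(γ₀)`; `F₁ ∈ C_c^∞(G)` whose support meets `closure 𝒪(γ₀)` only
inside `𝒪(γ₀)` and with `O_{γ₀}^m(F₁) = 0`.  THEN some `Ψ ∈ C₀ = span{φ^x − φ : φ ∈ C_c^∞(G)}` agrees with `F₁` on `𝒪(γ₀)` and has support disjoint from `Z`.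
Proof: §2 (the transported orbit measure `μ_O` on `↥𝒪(γ₀)`: invariant, finite on compacta, positive on opens, `∫ (F₁ ∘ ↑) dμ_O = O_{γ₀}^m(F₁) = 0`), §1 (COINV-1
primal: `F₁ ∘ ↑ ∈ span{φ(c • ·) − φ}`, the orbit maps being open by Mathlib's `isOpenMap_smul_of_sigmaCompact` on the Baire space `↥𝒪(γ₀)` and `K₀` a compact open
subgroup of `ConjAct G` by ★ van Dantzig), §3 (lift off `Z`). [cite: Rogawski1990, §8.1 p. 113] [cite: Howe1974, Prop. 2] [cite: BernsteinZelevinsky1976, §1.18]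
[cite: HarishChandra1999AdmissibleDistributions, §3.1 p. 17] -/
theorem exists_mem_span_conj_sub_eqOn_of_orbitalIntegral_eq_zero (γ₀ : G)
    [MeasurableSpace (G ⧸ Subgroup.centralizer ({γ₀} : Set G))] [BorelSpace (G ⧸ Subgroup.centralizer ({γ₀} : Set G))]
    (hO : IsLocallyClosed (orbit (ConjAct G) γ₀))
    (m : Measure (G ⧸ Subgroup.centralizer ({γ₀} : Set G))) [SMulInvariantMeasure G (G ⧸ Subgroup.centralizer ({γ₀} : Set G)) m] (hm : m ≠ 0)
    (hRao : ∀ f : G → ℂ, IsLocSmooth f →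
      Integrable (descConj γ₀ (Subgroup.centralizer ({γ₀} : Set G)) (fun _ hg => Subgroup.mem_centralizer_singleton_iff.1 hg) f) m)
    {Z : Set G} (hZ : IsClosed Z) (hZinv : ∀ x g : G, g ∈ Z → x * g * x⁻¹ ∈ Z) (hZO : Disjoint Z (orbit (ConjAct G) γ₀))
    {F₁ : G → ℂ} (hF₁ : IsLocSmooth F₁) (hsupp : tsupport F₁ ∩ closure (orbit (ConjAct G) γ₀) ⊆ orbit (ConjAct G) γ₀)
    (h0 : orbitalIntegral γ₀ F₁ m = 0) :
    ∃ Ψ : G → ℂ, Ψ ∈ Submodule.span ℂ {ψ : G → ℂ | ∃ (x : G) (φ : G → ℂ), IsLocSmooth φ ∧ ψ = (fun g => φ (x * g * x⁻¹)) - φ} ∧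
      (∀ g ∈ orbit (ConjAct G) γ₀, Ψ g = F₁ g) ∧ Disjoint (tsupport Ψ) Z := by
  -- the conjugation action on the stratum: topological instances on the synonym `ConjAct G` and on the subtype `↥𝒪(γ₀)`
  letI : TopologicalSpace (ConjAct G) := ‹TopologicalSpace G›
  haveI : IsTopologicalGroup (ConjAct G) := ‹IsTopologicalGroup G›
  haveI : SigmaCompactSpace (ConjAct G) := (inferInstance : SigmaCompactSpace G)
  haveI : T2Space (ConjAct G) := ‹T2Space G›
  haveI : TotallyDisconnectedSpace (ConjAct G) := ‹TotallyDisconnectedSpace G›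
  haveI : LocallyCompactSpace (ConjAct G) := ‹LocallyCompactSpace G›
  haveI : LocallyCompactSpace (orbit (ConjAct G) γ₀) := hO.locallyCompactSpace
  haveI : ContinuousSMul (ConjAct G) (orbit (ConjAct G) γ₀) := by
    refine ⟨?_⟩
    have h1 : Continuous fun p : ConjAct G × orbit (ConjAct G) γ₀ =>
        (ConjAct.ofConjAct p.1) * (p.2 : G) * (ConjAct.ofConjAct p.1)⁻¹ := by
      have hc1 : Continuous fun p : ConjAct G × orbit (ConjAct G) γ₀ => (ConjAct.ofConjAct p.1 : G) := continuous_fst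
      have hc2 : Continuous fun p : ConjAct G × orbit (ConjAct G) γ₀ => ((p.2 : G)) := continuous_subtype_val.comp continuous_snd
      exact (hc1.mul hc2).mul hc1.inv
    exact Continuous.subtype_mk h1 _
  have hopen : ∀ x : orbit (ConjAct G) γ₀, IsOpenMap fun g : ConjAct G => g • x := fun x => isOpenMap_smul_of_sigmaCompact x
  obtain ⟨K₀, hK₀o, hK₀c⟩ := Literature.Topology.Algebra.exists_isCompact_isOpen_subgroup (G := ConjAct G)
  -- the transported orbit measure
  set θ := Set.codRestrict (descConj γ₀ (Subgroup.centralizer ({γ₀} : Set G)) (fun _ hg => Subgroup.mem_centralizer_singleton_iff.1 hg) id)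
        (orbit (ConjAct G) γ₀) (descConj_id_mem_orbit γ₀) with hθ
  set μ : Measure (orbit (ConjAct G) γ₀) := m.map θ with hμ
  haveI : SMulInvariantMeasure (ConjAct G) (orbit (ConjAct G) γ₀) μ := smulInvariantMeasure_map_codRestrict_descConj_id γ₀ m
  haveI : IsFiniteMeasureOnCompacts μ := isFiniteMeasureOnCompacts_map_codRestrict_descConj_id γ₀ m hRao
  haveI : μ.IsOpenPosMeasure :=
    isOpenPosMeasure_of_smulInvariantMeasure_ne_zero (G := ConjAct G)
      (fun x => show Continuous fun g : ConjAct G => g • x by fun_prop) μ (map_codRestrict_descConj_id_ne_zero γ₀ m hm)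
  -- the restriction of `F₁` to the stratum is a test function with vanishing integral
  have hψ : IsLocallyConstant fun x : orbit (ConjAct G) γ₀ => F₁ (x : G) := hF₁.1.comp_continuous continuous_subtype_val
  have hψs : HasCompactSupport fun x : orbit (ConjAct G) γ₀ => F₁ (x : G) :=
    hasCompactSupport_comp_coe_of_tsupport_inter_closure_subset hF₁.2 hsupp
  have hint : ∫ x, F₁ (x : G) ∂μ = 0 := by
    rw [hμ, hθ, integral_comp_coe_map_eq_orbitalIntegral γ₀ m hF₁.continuous.measurable, h0]
  -- COINV-1 (primal) on the stratum, then the lift off `Z`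
  have hmem := mem_span_smul_sub_of_integral_eq_zero K₀ hK₀o hK₀c hopen μ hψ hψs hint
  obtain ⟨Ψ, hΨ, hΨF, hΨZ⟩ := exists_mem_span_conj_sub_comp_coe_eq γ₀ hZ hZinv hZO hmem
  exact ⟨Ψ, hΨ, fun g hg => congrFun hΨF ⟨g, hg⟩, hΨZ⟩

end StratumStep

end Literature.MeasureTheory.Group

end
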